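import Mathlib.GroupTheory.Perm.Fin
import Literature.AnabelianGeometry.AbsoluteAnabelian.AbsTopIII.CuspidalCyclotome
import Literature.AnabelianGeometry.AbsoluteAnabelian.ZHatCompletionFreeProcyclic
import Literature.AnabelianGeometry.AbsoluteAnabelian.SubpadicExamples
import HarnessLib

/-!
# Schema witnesses for the `CurveModel`-relative facts Prop. 1.4 (i), (ii) and Prop. 1.6 (i) of [AbsTopIII] §1

Mochizuki, *Topics in Absolute Anabelian Geometry III*, §1, Prop. 1.4 (i), (ii) p. 31 and Prop. 1.6 (i)
p. 34 (manuscript pages, lit key `paper:url-5493eb38cbb7`).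

The tree records these statements as NAMED FACTS RELATIVE TO A MODEL `M : CurveModel` /
`M : KummerCurveModel` (`CurveModel.Prop_1_4_i'`, `CurveModel.Prop_1_4_ii`, `Prop_1_6_i`; FACT-LIST rows
F-0340, F-0341, F-0342 of the abc-iut cell): the interface `CurveModel` is the assignment an étale
fundamental group functor WOULD provide and carries no axiom tying `M.ext U` to a curve.  This file makes
the schema status of the three rows kernel-visible (plan header rule (ii) for parametrised rows): their
universal closures over ALL models are FALSE, by explicit finite / procyclic TOY MODELS (junk data, not
models of any curve):

* `toyModel k H` — one curve `U` over a field `k` of characteristic zero with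
  `Π_U := G_k × H ↠ G_k` (`H` any profinite group), one cusp with decomposition group `Π_U` (so
  `I = Δ_U = {1} × H`, rational), `U` cofinite-open in itself with `res :=` "kill the `H`-factor"
  `(g, h) ↦ (g, 1)` (cuspidal kernel `= Δ_U`, the closed normal closure of `I`);
* `CurveModel.not_forall_prop_1_4_i'` (F-0340): with `H = 𝔖₃`, `res` is not surjective;
* `CurveModel.not_forall_prop_1_4_ii` (F-0341): with `H = 𝔖₃`, `[N, Δ] ∋ (1, [σ, τ]) ≠ 1` lies in `I`,
  so the injectivity clause `I ∩ [N, Δ]⁻ = 1` fails (the exactness clause always holds,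
  `CurveModelProp14iiReduction.lean`); with `H` commutative the property HOLDS
  (`isCuspidallyCentralExtension_toyKill_of_comm`) — a model witness;
* `not_forall_prop_1_6_i_of_isKummerFaithful` / `not_forall_prop_1_6_i_of_rmk_1_5_4_i` (F-0342): with
  `H = Ẑ` (Mathlib's profinite completion of `ℤ`, free procyclic) the single cusp IS a cyclotome
  presentation, and the Kummer datum `Γ(U, 𝒪^×) := k^×`, `κ_U := 1` is not injective; the row's own
  hypothesis "`k` Kummer-faithful" is not dischargeable for any concrete field in the tree (its
  abelian-variety clause is Mordell–Weil-type content), so the refutation is stated over ANY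
  Kummer-faithful `k` of characteristic zero, and under the cone's named fact `Rmk_1_5_4_i`
  (sub-`p`-adic ⟹ Kummer-faithful) at `k = ℚ_2`.

Consequence of record: the three rows are facts only AT THE INTENDED INSTANCE (the étale `π₁` model, not
constructed in the tree); consumers keep citing them BY NAME as hypotheses on `M`.  HONEST FRAMING:
statements about OUR typed interface, not about print; nothing here bears on [IUTchIII] Cor. 3.12; no side
taken.
-/

noncomputable section

open CategoryTheory
open scoped Pointwise

namespace Literature.AnabelianGeometry.AbsoluteAnabelian.AbsTopIII

namespace CurveModelSchemaWitness

variable (k : Type) [Field k] [CharZero k] (H : ProfiniteGrp.{0})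

/-! ### The toy extension `G_k × H ↠ G_k` -/

/-- TOY DATA: the extension `1 → {1} × H → G_k × H → G_k → 1` (first projection).
[cite: MochizukiAbsTopIII2015, Prop 1.4 p.31] -/
abbrev toyExt : FundamentalExtension.{0} where
  arith := ProfiniteGrp.of (Field.absoluteGaloisGroup k × H)
  gal := absoluteGaloisGrp k
  aug := ContinuousMonoidHom.fst (Field.absoluteGaloisGroup k) H
  aug_surjective := Prod.fst_surjective

/-- Membership in the geometric part `Δ = {1} × H` of the toy extension.
[cite: MochizukiAbsTopIII2015, Prop 1.4 p.31] -/
theorem mem_geom_toyExt {x : Field.absoluteGaloisGroup k × H} :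
    x ∈ (toyExt k H).geom ↔ x.1 = 1 :=
  Iff.rfl

/-- TOY DATA: the endomorphism "kill the `H`-factor" `(g, h) ↦ (g, 1)` of the toy extension over the
identity of `G_k` (plays the cuspidal quotient `Π_U ↠ Π_{U'}`). [cite: MochizukiAbsTopIII2015, Prop 1.4 (i) p.31] -/
abbrev toyKill : toyExt k H ⟶ toyExt k H where
  arith := (ContinuousMonoidHom.inl (Field.absoluteGaloisGroup k) H).comp
    (ContinuousMonoidHom.fst (Field.absoluteGaloisGroup k) H)
  gal := ContinuousMonoidHom.id _
  comm _ := rfl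

/-- The value of the killing map. [cite: MochizukiAbsTopIII2015, Prop 1.4 (i) p.31] -/
@[simp] theorem toyKill_arith_apply (x : Field.absoluteGaloisGroup k × H) :
    (toyKill k H).arith x = (x.1, 1) :=
  rfl

/-- The kernel of the killing map is `Δ = {1} × H`. [cite: MochizukiAbsTopIII2015, Prop 1.4 (i) p.31] -/
theorem ker_toyKill : (toyKill k H).arith.toMonoidHom.ker = (toyExt k H).geom := by
  ext x
  rw [MonoidHom.mem_ker, mem_geom_toyExt]
  change ((x.1, (1 : H)) : Field.absoluteGaloisGroup k × H) = 1 ↔ x.1 = 1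
  rw [Prod.mk_eq_one]
  exact and_iff_left rfl

/-- Hence the cuspidal kernel `N = Ker ∩ Δ` of the killing map is `Δ`.
[cite: MochizukiAbsTopIII2015, Prop 1.4 (ii) p.31] -/
theorem cuspidalKernel_toyKill : cuspidalKernel (toyKill k H) = (toyExt k H).geom := by
  unfold cuspidalKernel
  rw [ker_toyKill, inf_idem]

/-! ### One cusp with decomposition group everything -/

/-- TOY DATA: cuspidal data with ONE cusp whose decomposition group is all of `Π` (so its inertia
group is `Δ` and the cusp is rational). [cite: MochizukiAbsTopIII2015, Prop 1.4 (i) p.31] -/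
abbrev topCusps (E : FundamentalExtension.{0}) : E.CuspidalData where
  Cusp := PUnit
  Dcusp _ := ⊤
  Icusp _ := ⊤ ⊓ E.geom
  Icusp_eq _ := rfl
  isClosed_Dcusp _ := by
    rw [Subgroup.coe_top]
    exact isClosed_univ
  eq_of_conj _ _ _ _ := rfl

/-- The inertia group of the single cusp is `Δ`. [cite: MochizukiAbsTopIII2015, Prop 1.4 (i) p.31] -/
theorem Icusp_topCusps (E : FundamentalExtension.{0}) (x : (topCusps E).Cusp) :
    (topCusps E).Icusp x = E.geom :=
  top_inf_eq E.geom

/-- The single cusp is rational (`D = Π` surjects onto `G`). [cite: MochizukiAbsTopIII2015, Prop 1.6 (ii) p.35] -/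
theorem isRational_topCusps (E : FundamentalExtension.{0}) (x : (topCusps E).Cusp) :
    (topCusps E).IsRational x := by
  intro g _
  obtain ⟨y, hy⟩ := E.aug_surjective g
  exact ⟨y, Subgroup.mem_top y, hy⟩

/-- A closed normal subgroup is its own closed normal closure.
[cite: MochizukiAbsTopIII2015, Prop 1.4 (i) p.31] -/
theorem topologicalClosure_normalClosure_eq_self {G : Type*} [Group G] [TopologicalSpace G]
    [IsTopologicalGroup G] (N : Subgroup G) [N.Normal] (hN : IsClosed (N : Set G)) :
    (Subgroup.normalClosure (N : Set G)).topologicalClosure = N := by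
  rw [Subgroup.normalClosure_eq_self]
  exact le_antisymm (Subgroup.topologicalClosure_minimal _ le_rfl hN) (Subgroup.le_topologicalClosure _)

/-! ### The toy model -/

/-- **TOY MODEL** of the interface `CurveModel`: one curve over `k` with `Π := G_k × H ↠ G_k`, one cusp
with decomposition group `Π`, all predicates `True`, the curve cofinite-open in itself with
`res :=` the killing map.  Junk data exhibiting the schema status of the `CurveModel`-relative facts;
not a model of any curve. [cite: MochizukiAbsTopIII2015, Prop 1.4 p.31] -/
abbrev toyModel : CurveModel.{0} where
  Curve := PUnit
  base _ := k
  ext _ := toyExt k H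
  galIso _ := Iso.refl _
  cusps _ := topCusps (toyExt k H)
  IsProper _ := True
  IsScheme _ := True
  genus _ := 0
  FunctionField _ := k
  Point _ := PUnit
  decomp _ _ := ⊥
  IsNFCurve _ := True
  IsNFPoint _ _ := True
  IsNFRational _ _ := True
  IsNFConstant _ _ := True
  NFFunctionField _ := k
  IsStrictlyBelyiType _ := True
  IsCofiniteOpen _ _ := True
  res _ := toyKill k H

/-- In the toy model the hypothesis of Prop. 1.4 (ii) on the cuspidal kernel holds: `N = Δ` is the closed
normal closure of `I = Δ`. [cite: MochizukiAbsTopIII2015, Prop 1.4 (ii) p.31] -/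
theorem cuspidalKernel_toyKill_eq_closure (x : (topCusps (toyExt k H)).Cusp) :
    cuspidalKernel (toyKill k H) =
      (Subgroup.normalClosure ((topCusps (toyExt k H)).Icusp x :
        Set (toyExt k H).arith)).topologicalClosure := by
  haveI : (toyExt k H).geom.Normal := FundamentalExtension.normal_geom _
  rw [cuspidalKernel_toyKill, Icusp_topCusps,
    topologicalClosure_normalClosure_eq_self _ (toyExt k H).isClosed_geom]

/-! ### F-0340: the universal closure of `Prop_1_4_i'` is false -/

/-- `𝔖₃` with the discrete topology, as a profinite group. [cite: MochizukiAbsTopIII2015, Prop 1.4 p.31] -/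
abbrev S₃ : ProfiniteGrp.{0} := ProfiniteGrp.ofFiniteGrp (FiniteGrp.of (Equiv.Perm (Fin 3)))

/-- A transposition of `𝔖₃`. [cite: MochizukiAbsTopIII2015, Prop 1.4 p.31] -/
abbrev τ : Equiv.Perm (Fin 3) := Equiv.swap 0 1

/-- A `3`-cycle of `𝔖₃`. [cite: MochizukiAbsTopIII2015, Prop 1.4 p.31] -/
abbrev σ : Equiv.Perm (Fin 3) := Equiv.swap 0 1 * Equiv.swap 1 2

/-- **FACT-LIST F-0340 — the universal closure of `CurveModel.Prop_1_4_i'` is FALSE.**  In the toy model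
over `ℚ` with `H = 𝔖₃` the "cuspidal quotient" `res` kills the `𝔖₃`-factor and is not surjective.
Schema row: Prop. 1.4 (i) is a fact only at the intended (étale `π₁`) instance.
[cite: MochizukiAbsTopIII2015, Prop 1.4 (i) p.31] -/
theorem _root_.Literature.AnabelianGeometry.AbsoluteAnabelian.AbsTopIII.CurveModel.not_forall_prop_1_4_i' :
    ¬ ∀ M : CurveModel.{0}, M.Prop_1_4_i' := by
  intro h
  obtain ⟨x, hx⟩ := (h (toyModel ℚ S₃) PUnit.unit PUnit.unit trivial trivial trivial).1
    ((1 : Field.absoluteGaloisGroup ℚ), (τ : S₃))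
  have h2 : (1 : Equiv.Perm (Fin 3)) = τ := congrArg Prod.snd hx
  exact absurd h2 (by decide)

/-! ### F-0341: the universal closure of `Prop_1_4_ii` is false; a commutative model witness -/

/-- **FACT-LIST F-0341 — the universal closure of `CurveModel.Prop_1_4_ii` is FALSE.**  In the toy model
over `ℚ` with `H = 𝔖₃`: `X := U` is "proper", the cusp is rational, `N = Δ = {1} × 𝔖₃` is the closed
normal closure of `I = Δ`, but `[N, Δ] ∋ (1, [σ, τ])` is a non-trivial element of `I ∩ [N, Δ]⁻`, so the
injectivity clause of `IsCuspidallyCentralExtension` fails.  Schema row: Prop. 1.4 (ii) is a fact only at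
the intended (étale `π₁`) instance. [cite: MochizukiAbsTopIII2015, Prop 1.4 (ii) p.31] -/
theorem _root_.Literature.AnabelianGeometry.AbsoluteAnabelian.AbsTopIII.CurveModel.not_forall_prop_1_4_ii :
    ¬ ∀ M : CurveModel.{0}, M.Prop_1_4_ii := by
  intro h
  have hcc := h (toyModel ℚ S₃) PUnit.unit PUnit.unit trivial trivial trivial trivial PUnit.unit
    (isRational_topCusps _ _) (cuspidalKernel_toyKill_eq_closure ℚ S₃ _)
  have hbot := hcc.inf_eq_bot
  rw [Icusp_topCusps] at hbot
  set a : Field.absoluteGaloisGroup ℚ × S₃ := (1, (σ : S₃)) with ha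
  set b : Field.absoluteGaloisGroup ℚ × S₃ := (1, (τ : S₃)) with hb
  have hmem : a * b * a⁻¹ * b⁻¹ ∈ (toyExt ℚ S₃).geom ⊓ cuspidallyCentralModulus (toyKill ℚ S₃) := by
    refine ⟨?_, ?_⟩
    · change (a * b * a⁻¹ * b⁻¹).1 = 1
      simp [ha, hb]
    · unfold cuspidallyCentralModulus
      rw [cuspidalKernel_toyKill]
      refine Subgroup.le_topologicalClosure _ ?_
      have hc := Subgroup.commutator_mem_commutator
        (show a ∈ (toyExt ℚ S₃).geom from rfl) (show b ∈ (toyExt ℚ S₃).geom from rfl)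
      rwa [commutatorElement_def] at hc
  rw [hbot, Subgroup.mem_bot] at hmem
  have h2 : σ * τ * σ⁻¹ * τ⁻¹ = (1 : Equiv.Perm (Fin 3)) := congrArg Prod.snd hmem
  exact absurd h2 (by decide)

/-- MODEL WITNESS for `Prop_1_4_ii`: in the toy model with `H` COMMUTATIVE the cuspidally-central-extension
property HOLDS at the single cusp (`[N, Δ] = [Δ, Δ] = 1`), so the hypotheses of the row are jointly
satisfiable together with its conclusion. [cite: MochizukiAbsTopIII2015, Prop 1.4 (ii) p.31] -/
theorem isCuspidallyCentralExtension_toyKill_of_comm (hH : ∀ a b : H, a * b = b * a)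
    (x : (topCusps (toyExt k H)).Cusp) :
    IsCuspidallyCentralExtension (toyKill k H) ((topCusps (toyExt k H)).Icusp x) := by
  have hmod : cuspidallyCentralModulus (toyKill k H) = ⊥ := by
    unfold cuspidallyCentralModulus
    rw [cuspidalKernel_toyKill]
    have hcomm : ⁅(toyExt k H).geom, (toyExt k H).geom⁆ = ⊥ := by
      rw [Subgroup.commutator_eq_bot_iff_le_centralizer]
      intro y hy z hz
      have hy' : y.1 = 1 := hy
      have hz' : z.1 = 1 := hz
      ext
      · simp [hy', hz']
      · exact hH z.2 y.2
    rw [hcomm]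
    refine le_antisymm (Subgroup.topologicalClosure_minimal _ le_rfl ?_) bot_le
    rw [Subgroup.coe_bot]
    exact isClosed_singleton
  refine ⟨?_, ?_⟩
  · rw [hmod, inf_bot_eq]
  · rw [hmod, sup_bot_eq, Icusp_topCusps, cuspidalKernel_toyKill]

/-- Hence `Prop_1_4_ii` HOLDS in every toy model with commutative `H` (non-vacuously: its hypotheses are
met at the single cusp). [cite: MochizukiAbsTopIII2015, Prop 1.4 (ii) p.31] -/
theorem prop_1_4_ii_toyModel_of_comm (hH : ∀ a b : H, a * b = b * a) : (toyModel k H).Prop_1_4_ii :=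
  fun _ _ _ _ _ _ x _ _ => isCuspidallyCentralExtension_toyKill_of_comm k H hH x

/-! ### F-0342: the universal closure of `Prop_1_6_i` is false over any Kummer-faithful base -/

/-- `Ẑ` — Mathlib's profinite completion of `ℤ` (free procyclic: `isFreeProcyclic_zHatCompletion`), the
`H` of the toy cyclotome presentation. [cite: MochizukiAbsTopIII2015, Prop 1.4 (i) p.31] -/
abbrev ZHat : ProfiniteGrp.{0} :=
  ProfiniteGrp.ProfiniteCompletion.completion (GrpCat.of (Multiplicative ℤ))

/-- `Ẑ` is commutative (it has a dense cyclic subgroup). [cite: MochizukiAbsTopIII2015, Prop 1.4 (i) p.31] -/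
theorem zHat_mul_comm (a b : ZHat) : a * b = b * a := by
  obtain ⟨g, hg⟩ := isFreeProcyclic_zHatCompletion.exists_dense_zpowers
  exact mul_comm_of_dense_zpowers hg a b

/-- `Ẑ ≃ₜ* I` for the single cusp of the toy extension `G_k × Ẑ ↠ G_k` (`I = Δ = {1} × Ẑ`).
[cite: MochizukiAbsTopIII2015, Prop 1.4 (i) p.31] -/
def zHatEquivIcusp (x : (topCusps (toyExt k ZHat)).Cusp) :
    ZHat ≃ₜ* (topCusps (toyExt k ZHat)).Icusp x where
  toFun z := ⟨(1, z), Subgroup.mem_inf.mpr ⟨Subgroup.mem_top _, (mem_geom_toyExt k ZHat).mpr rfl⟩⟩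
  invFun s := (s : Field.absoluteGaloisGroup k × ZHat).2
  left_inv _ := rfl
  right_inv s := by
    obtain ⟨⟨g, z⟩, hs⟩ := s
    have hg : g = 1 := (Subgroup.mem_inf.mp hs).2
    subst hg
    rfl
  map_mul' a b := Subtype.ext (Prod.ext (by simp) rfl)
  continuous_toFun := Continuous.subtype_mk (continuous_const.prodMk continuous_id) _
  continuous_invFun := continuous_snd.comp continuous_subtype_val

/-- The inertia group of the single cusp of `G_k × Ẑ ↠ G_k` is free procyclic ("`I_x ≅ Ẑ(1)`").
[cite: MochizukiAbsTopIII2015, Prop 1.4 (i) p.31] -/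
theorem isFreeProcyclic_Icusp_zHat (x : (topCusps (toyExt k ZHat)).Cusp) :
    FundamentalExtension.IsFreeProcyclic ((topCusps (toyExt k ZHat)).Icusp x) :=
  isFreeProcyclic_zHatCompletion.of_continuousMulEquiv (zHatEquivIcusp k x)

/-- In the toy model with `H = Ẑ` the single cusp IS a cyclotome presentation of `U ⊆ U`: scheme-like,
"proper", rational, `I ≅ Ẑ`, `N` the closed normal closure of `I`, and `1 → I → Δ^{c-cn} → Δ → 1` exact
(`Ẑ` is commutative). [cite: MochizukiAbsTopIII2015, Prop 1.4 (ii) p.31] -/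
theorem isCyclotomePresentation_toyModel_zHat (x : (topCusps (toyExt k ZHat)).Cusp) :
    (toyModel k ZHat).IsCyclotomePresentation (Ux := PUnit.unit) (X := PUnit.unit) trivial x where
  isScheme := ⟨trivial, trivial⟩
  isProper := trivial
  isRational := isRational_topCusps _ x
  isFreeProcyclic := isFreeProcyclic_Icusp_zHat k x
  kernel_eq := cuspidalKernel_toyKill_eq_closure k ZHat x
  isCuspidallyCentral := isCuspidallyCentralExtension_toyKill_of_comm k ZHat zHat_mul_comm x

/-- **TOY KUMMER MODEL**: the toy model with `H = Ẑ` extended by the junk Kummer datum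
"`Γ(U, 𝒪_U^×) := k^×` (all units of `K_U = k`), `κ_U := 1`".  Not a model of any curve.
[cite: MochizukiAbsTopIII2015, Prop 1.6 p.34] -/
abbrev toyKummerModel : KummerCurveModel.{0} where
  toCurveModel := toyModel k ZHat
  regularUnits _ := ⊤
  kummer _ _ := 1

/-- The toy Kummer map is not injective (`1 ≠ 2` in `k^×`, both regular units, both sent to `0`).
[cite: MochizukiAbsTopIII2015, Prop 1.6 (i) p.34] -/
theorem not_injective_kummer_toyKummerModel :
    ¬ Function.Injective ((toyKummerModel k).kummer (U := PUnit.unit) (Ux := PUnit.unit)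
      (X := PUnit.unit) trivial trivial) := by
  intro hinj
  have h12 := @hinj ⟨1, Subgroup.mem_top _⟩ ⟨Units.mk0 (2 : k) two_ne_zero, Subgroup.mem_top _⟩
    (by simp)
  have h12' : ((1 : kˣ) : k) = (Units.mk0 (2 : k) two_ne_zero : k) :=
    congrArg (fun u : (⊤ : Subgroup kˣ) => ((u : kˣ) : k)) h12
  norm_num at h12'

/-- `Prop_1_6_i` FAILS for the toy Kummer model as soon as its base field is Kummer-faithful.
[cite: MochizukiAbsTopIII2015, Prop 1.6 (i) p.34] -/
theorem not_prop_1_6_i_toyKummerModel (hk : IsKummerFaithful k) : ¬ Prop_1_6_i (toyKummerModel k) :=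
  fun h => not_injective_kummer_toyKummerModel k
    (h PUnit.unit PUnit.unit PUnit.unit trivial trivial PUnit.unit trivial
      (isCyclotomePresentation_toyModel_zHat k PUnit.unit) hk)

/-- **FACT-LIST F-0342 — the universal closure of `Prop_1_6_i` is FALSE over any Kummer-faithful base**:
for every Kummer-faithful field `k` of characteristic zero the toy Kummer model over `k` (cyclotome
presentation with `I ≅ Ẑ`, `κ_U := 1` on `k^×`) violates the injectivity of the Kummer map.  (The
hypothesis is the row's own: no concrete field is proved Kummer-faithful in the tree — the
abelian-variety clause of `IsKummerFaithful` is Mordell–Weil-type content.)  Schema row: Prop. 1.6 (i)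
is a fact only at the intended (étale `π₁` + geometric Kummer map) instance.
[cite: MochizukiAbsTopIII2015, Prop 1.6 (i) p.34] -/
theorem _root_.Literature.AnabelianGeometry.AbsoluteAnabelian.AbsTopIII.not_forall_prop_1_6_i_of_isKummerFaithful
    (hk : IsKummerFaithful k) : ¬ ∀ M : KummerCurveModel.{0}, Prop_1_6_i M :=
  fun h => not_prop_1_6_i_toyKummerModel k hk (h _)

/-- **F-0342 under the cone's own named fact `Rmk_1_5_4_i`** ("sub-`p`-adic ⟹ Kummer-faithful",
FACT-LIST F-0369): `ℚ_2` is sub-`2`-adic, hence Kummer-faithful, and the toy Kummer model over `ℚ_2`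
refutes the universal closure of `Prop_1_6_i`. [cite: MochizukiAbsTopIII2015, Prop 1.6 (i) p.34] -/
theorem _root_.Literature.AnabelianGeometry.AbsoluteAnabelian.AbsTopIII.not_forall_prop_1_6_i_of_rmk_1_5_4_i
    (h154 : Rmk_1_5_4_i.{0}) : ¬ ∀ M : KummerCurveModel.{0}, Prop_1_6_i M :=
  not_forall_prop_1_6_i_of_isKummerFaithful ℚ_[2]
    (h154 ℚ_[2] ⟨⟨2, inferInstance, IsSubpadicFor.padic 2⟩⟩)

end CurveModelSchemaWitness

end Literature.AnabelianGeometry.AbsoluteAnabelian.AbsTopIII
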